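import Mathlib
import Summits.Ventures.HodgeRepro2.T6N42ToyNSide

/-!
# T6N42ToyNSideP — the toy N4 side with its ARCHIMEDEAN FACTORS AS A PARAMETER (owner t6-p5; the
t6-p5 × t6-p6 seam of the lead's M2 v5 joint toy, t6-lead STATUS l. 11168 (3))

T6N42ToyNSide's `toyNSide` fixes the real-place factors of its doubling-`L` datum to the N4.3 toys'
Eischen–Liu `Γ_ℂ`-products (`toyLvArch`). The v5 joint toy needs the SAME side with `d43` = t6-p6's
Bergman places and the real-place factors `Lv (Sum.inr j)` = the Bergman `Lfac`s, so that t6-p6's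
Eischen–Liu displays fit the N4.3 slots and N4.1's lemma set is re-proved on the re-normalised
datum. This file is that shape — ONE datum, ONE proof set, parametric: `toyD41P Larch` (the toy
doubling-`L` datum with `Lv (Sum.inr j) := Larch j`, everything else as in `toyD41`;
`toyD41P toyLvArch = toyD41` by `rfl`) and `toyNSideP d43 Larch : NSide` for ANY N4.3 places
datum `d43` and ANY archimedean factors `Larch`. What N4.1's lemma set needs of a real-place factor
is only that it be of Eischen–Liu shape for SOME weight / twist data — `ELShape L` — which gives
holomorphy at `s = 1` (`analyticAt_one_of_eischenLiu`) and meromorphy on `ℂ` with order `≤ 0` at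
`1` (t6-p4's `archimedean_hyp_of_gammaC_shape`); under `hL : ∀ j, ELShape (Larch j)` every binder
of `N41_main` / `N41_mainE` holds on `toyD41P Larch` (`toyD41P_N41E`), `(H_loc)` and
`R1AndHloc` hold on the side (`toyNSideP_R1AndHloc`), and `ArchNonvanishing` follows from t6-p6's
ten N4.3 binders on `d43` with the factors `Larch` (`toyNSideP_archNonvanishing`, through
`N43Places.archNonvanishing_withLfac`, the factors `(toyNSideP d43 Larch).d41.Lv (Sum.inr j)` being
`Larch j` by `rfl`) — `toyNSideP_N4` packages both. The original toy is the instance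
`toyNSideP N43Places.toy toyLvArch = toyNSide` (`rfl`). The Bergman instance is
`toyNSideP N43Toy.bergmanToy.toPlaces bergmanLfac` with t6-p6's displays as the ten binders and
`hL j := elShape_of_eischenLiu (the same displays)` — t6-p6's / the lead's one-liner.

README §8(d): uses an L-value-free non-vanishing device: NO (TIER5 §N4.1 / §N4.3 as consumed by
the lead's composition; the toy asserts nothing about an `L`-value — its factors are the record's
`Γ_ℂ`-products, holomorphic at `s = 1`).
-/

namespace Summit.Ventures.HodgeRepro2.T6.N42ToyNSideP

open Summit.Ventures.HodgeRepro2
open Summit.Ventures.HodgeRepro2.T6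
open Summit.Ventures.HodgeRepro2.T6.N42Datum
open Summit.Ventures.HodgeRepro2.T6.N42Toy
open Summit.Ventures.HodgeRepro2.T6.N42ToyNSide

/-! ### Archimedean factors of Eischen–Liu shape -/

/-- A factor of Eischen–Liu shape for SOME weight `(τ; ν)` and twist `r` (t6-p6's display
`Hyp.EischenLiu2024_Sec2_2`): the only property of a real-place factor N4.1's lemma set uses. -/
def ELShape (L : ℂ → ℂ) : Prop :=
  ∃ (a b : ℕ) (τ : Fin a → ℤ) (ν : Fin b → ℤ) (r : ℤ), Hyp.EischenLiu2024_Sec2_2 a b τ ν r L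

/-- An Eischen–Liu display gives the shape. -/
theorem elShape_of_eischenLiu {a b : ℕ} {τ : Fin a → ℤ} {ν : Fin b → ℤ} {r : ℤ} {L : ℂ → ℂ}
    (h : Hyp.EischenLiu2024_Sec2_2 a b τ ν r L) : ELShape L :=
  ⟨a, b, τ, ν, r, h⟩

/-- A factor of Eischen–Liu shape is holomorphic at `s = 1`. -/
theorem ELShape.analyticAt_one {L : ℂ → ℂ} (h : ELShape L) : AnalyticAt ℂ L 1 := by
  obtain ⟨a, b, τ, ν, r, hEL⟩ := h
  exact analyticAt_one_of_eischenLiu hEL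

/-- A factor of Eischen–Liu shape is meromorphic on `ℂ` with order `≤ 0` at `s = 1` (t6-p4's
`archimedean_hyp_of_gammaC_shape`). -/
theorem ELShape.meromorphic {L : ℂ → ℂ} (h : ELShape L) :
    MeromorphicOn L Set.univ ∧ meromorphicOrderAt L 1 ≤ 0 := by
  obtain ⟨a, b, τ, ν, r, hEL⟩ := h
  exact N41Core.archimedean_hyp_of_gammaC_shape _ _ hEL 1

/-- The N4.3 toys' factors are of Eischen–Liu shape. -/
theorem elShape_toyLvArch (j : Fin 3) : ELShape (toyLvArch j) := by
  match j with
  | 0 => exact elShape_of_eischenLiu N43Toy.toyU2_EL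
  | 1 => exact elShape_of_eischenLiu N43Toy.toyU11_EL
  | 2 => exact elShape_of_eischenLiu N43Toy.toyU11_EL

/-! ### The parametric toy doubling-`L` datum -/

/-- The local factors: `1` at the finite places, the parameter `Larch j` at the real place `j`. -/
noncomputable def LvP (Larch : Fin 3 → ℂ → ℂ) : ToyPlace → ℂ → ℂ :=
  Sum.elim (fun _ _ => 1) Larch

/-- The toy doubling-`L` datum with the archimedean factors as a parameter: `S` = all places,
`Lv := LvP Larch`, `L = ∏_v L_v`, `(H_loc)` true everywhere, the auxiliary Hecke `L`-functions and
their Euler factors `≡ 1`, both characters non-trivial — `toyD41` with `toyLvArch` replaced by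
`Larch`. -/
noncomputable def toyD41P (Larch : Fin 3 → ℂ → ℂ) : DoublingLDatum ToyPlace where
  S := Finset.univ
  Lv := LvP Larch
  L := ∏ v, LvP Larch v
  thetaNonzero := fun _ => True
  L₁ := fun _ => 1
  L₂ := fun _ => 1
  g₁ := fun _ _ => 1
  g₂ := fun _ _ => 1
  triv₁ := False
  triv₂ := False

/-- The original toy datum is the instance at the N4.3 toys' factors. -/
theorem toyD41P_toyLvArch : toyD41P toyLvArch = toyD41 := rfl

/-- The real-place factor of the parametric datum is the parameter. -/
theorem toyD41P_Lv_inr (Larch : Fin 3 → ℂ → ℂ) (j : Fin 3) :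
    (toyD41P Larch).Lv (Sum.inr j) = Larch j := rfl

section Lemmas

variable {Larch : Fin 3 → ℂ → ℂ}

/-- Every local factor is holomorphic at `s = 1` (the real-place factors by their shape). -/
theorem analyticAt_LvP_one (hL : ∀ j, ELShape (Larch j)) (v : ToyPlace) :
    AnalyticAt ℂ (LvP Larch v) 1 := by
  rcases v with w | j
  · exact analyticAt_const
  · exact (hL j).analyticAt_one

/-- Every local factor is meromorphic on `ℂ` and zero-free at `s = 1`. -/
theorem meromorphic_LvP (hL : ∀ j, ELShape (Larch j)) (v : ToyPlace) :
    MeromorphicOn (LvP Larch v) Set.univ ∧ meromorphicOrderAt (LvP Larch v) 1 ≤ 0 := by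
  rcases v with w | j
  · refine ⟨analyticOnNhd_const.meromorphicOn, ?_⟩
    exact (T5OrderCounting.meromorphicOrderAt_eq_zero_of_ne_zero analyticAt_const one_ne_zero).le
  · exact (hL j).meromorphic

/-! ### The N4.1 displays and binders on the parametric datum -/

/-- GQT Thm 11.4(ii): `L = ∏_v L_v` is holomorphic at `s = 1`. -/
theorem toyD41P_GQT (hL : ∀ j, ELShape (Larch j)) : Hyp.GQT2014_Thm11_4_ii (toyD41P Larch) :=
  fun _ => show AnalyticAt ℂ (∏ v, LvP Larch v) 1 from
    Finset.analyticAt_prod _ fun v _ => analyticAt_LvP_one hL v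

/-- Lapid–Rallis §10 (global): `L(s) = ∏'_v L_v(s)` (a finite product) and `L` is meromorphic. -/
theorem toyD41P_LR (hL : ∀ j, ELShape (Larch j)) :
    Hyp.LapidRallis2005_Sec10_GlobalL (toyD41P Larch) :=
  ⟨fun s _ => by simp [toyD41P, Finset.prod_apply, tprod_fintype],
    N41Core.meromorphicOn_prod fun v _ => (meromorphic_LvP hL v).1⟩

/-- Lapid–Rallis §10 (`p`-adic shape) away from the real places: `L_v ≡ 1 = (1)⁻¹`. -/
theorem toyD41P_padic : Hyp.LapidRallis2005_Sec10_padic (toyD41P Larch) toyA := by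
  intro v _ hvA
  rcases v with w | j
  · exact ⟨1, 2, by norm_num, one_ne_zero, fun s => by simp [toyD41P, LvP]⟩
  · exact absurd (inr_mem_toyA j) hvA

/-- Iwasawa §3.1 (`a = 0`, `q = 2`, `L₁ = ∏' 1 = 1`). -/
theorem toyD41P_euler₁ :
    Hyp.Iwasawa2019_Sec3_1_EulerProduct (toyD41P Larch).L₁ (toyD41P Larch).g₁ := by
  refine ⟨fun _ => 0, fun _ => 2, fun _ => by simp, fun _ => by norm_num,
    fun _ _ => by simp [toyD41P], fun s _ => ⟨by simp [toyD41P], by simp [toyD41P]⟩⟩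

/-- Iwasawa §3.1 for the second character. -/
theorem toyD41P_euler₂ :
    Hyp.Iwasawa2019_Sec3_1_EulerProduct (toyD41P Larch).L₂ (toyD41P Larch).g₂ := by
  refine ⟨fun _ => 0, fun _ => 2, fun _ => by simp, fun _ => by norm_num,
    fun _ _ => by simp [toyD41P], fun s _ => ⟨by simp [toyD41P], by simp [toyD41P]⟩⟩

/-- Iwasawa Thm 3.1 (`L₁ ≡ 1` entire; `triv₁ = False`). -/
theorem toyD41P_thm31₁ : Hyp.Iwasawa2019_Thm3_1 (toyD41P Larch).L₁ (toyD41P Larch).triv₁ :=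
  ⟨fun _ _ => analyticAt_const.meromorphicAt, fun _ _ _ => analyticAt_const, fun h => h.elim⟩

/-- Iwasawa Thm 3.1 for the second character. -/
theorem toyD41P_thm31₂ : Hyp.Iwasawa2019_Thm3_1 (toyD41P Larch).L₂ (toyD41P Larch).triv₂ :=
  ⟨fun _ _ => analyticAt_const.meromorphicAt, fun _ _ _ => analyticAt_const, fun h => h.elim⟩

/-- Iwasawa Prop. 4.4 (`1 ≠ 0`). -/
theorem toyD41P_prop44₁ : Hyp.Iwasawa2019_Prop4_4 (toyD41P Larch).L₁ (toyD41P Larch).triv₁ :=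
  fun _ _ => one_ne_zero

/-- Iwasawa Prop. 4.4 for the second character. -/
theorem toyD41P_prop44₂ : Hyp.Iwasawa2019_Prop4_4 (toyD41P Larch).L₂ (toyD41P Larch).triv₂ :=
  fun _ _ => one_ne_zero

/-- The archimedean binder `harch` of `N41_main` at the three real places. -/
theorem toyD41P_harch (hL : ∀ j, ELShape (Larch j)) : ∀ v ∈ toyA,
    MeromorphicOn ((toyD41P Larch).Lv v) Set.univ ∧
      meromorphicOrderAt ((toyD41P Larch).Lv v) 1 ≤ 0 :=
  fun v _ => meromorphic_LvP hL v

/-- The unramified binder `hunr` is vacuous (`S` = all places). -/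
theorem toyD41P_hunr : ∀ v ∉ (toyD41P Larch).S, ∀ s : ℂ,
    (toyD41P Larch).Lv v s = (toyD41P Larch).g₁ v s * (toyD41P Larch).g₂ v s :=
  fun v hv => absurd (Finset.mem_univ v) hv

/-- `(H_loc)`. -/
theorem toyD41P_hloc : (toyD41P Larch).Hloc := fun _ => trivial

/-- Iwasawa §3.1 in t6-p4's prime-indexed form (`κ = Empty`, empty products). -/
theorem toyD41P_eulerE₁ :
    Hyp.Iwasawa2019_Sec3_1_EulerProductE (toyD41P Larch).L₁ (toyD41P Larch).g₁ := by
  refine ⟨Empty, fun e => e.elim, fun e => e.elim, fun e => e.elim, fun e => e.elim, fun e => e.elim,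
    fun _ => Set.toFinite _, fun v s => ?_, fun s _ => ⟨summable_empty, ?_⟩⟩
  · have : IsEmpty {𝔓 : Empty // (fun e : Empty => e.elim) 𝔓 = v} := ⟨fun x => x.1.elim⟩
    simp [toyD41P]
  · simp [toyD41P]

/-- The same for the second character. -/
theorem toyD41P_eulerE₂ :
    Hyp.Iwasawa2019_Sec3_1_EulerProductE (toyD41P Larch).L₂ (toyD41P Larch).g₂ :=
  toyD41P_eulerE₁ (Larch := Larch)

/-- N4.1 applied to the parametric datum: `(R1)` and both characters non-trivial, for ANY
archimedean factors of Eischen–Liu shape. -/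
theorem toyD41P_N41 (hL : ∀ j, ELShape (Larch j)) :
    (toyD41P Larch).R1 ∧ (toyD41P Larch).BothNontrivial :=
  N41Main.N41_main (toyD41P Larch) toyA (toyD41P_GQT hL) (toyD41P_LR hL) toyD41P_padic
    toyD41P_euler₁ toyD41P_euler₂ toyD41P_thm31₁ toyD41P_thm31₂ toyD41P_prop44₁ toyD41P_prop44₂
    (toyD41P_harch hL) toyD41P_hunr toyD41P_hloc

/-- N4.1 in the form `N4_main` consumes (`N41_mainE`) on the parametric datum. -/
theorem toyD41P_N41E (hL : ∀ j, ELShape (Larch j)) :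
    (toyD41P Larch).R1 ∧ (toyD41P Larch).BothNontrivial :=
  N41Main.N41_mainE (toyD41P Larch) toyA (toyD41P_GQT hL) (toyD41P_LR hL) toyD41P_padic
    toyD41P_eulerE₁ toyD41P_eulerE₂ toyD41P_thm31₁ toyD41P_thm31₂ toyD41P_prop44₁ toyD41P_prop44₂
    (toyD41P_harch hL) toyD41P_hunr toyD41P_hloc

end Lemmas

/-! ### The parametric toy side -/

/-- The toy N4 side with ANY N4.3 places datum `d43` and ANY archimedean factors `Larch`:
`d42` = the N4.2 toy, `d41 = toyD41P Larch`; `theta_fin` holds because `(H_loc)` is true on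
`toyD41P Larch` and `ThetaNonzeroAt` is true at every place of `toyFinitePlaces`. -/
noncomputable def toyNSideP (d43 : N43Places) (Larch : Fin 3 → ℂ → ℂ) : NSide where
  d42 := toyFinitePlaces
  d43 := d43
  d41 := toyD41P Larch
  theta_fin := fun v =>
    ⟨fun _ => (toyFinitePlaces.thetaNonzeroEverywhere_iff.mp
      toyFinitePlaces_thetaNonzeroEverywhere) v, fun _ => trivial⟩

/-- The original toy side is the instance at the N4.3 toy places and factors. -/
theorem toyNSideP_toy : toyNSideP N43Places.toy toyLvArch = toyNSide := rfl

/-- `(H_loc)` at the finite places, in N4.1's words. -/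
theorem toyNSideP_hloc_fin (d43 : N43Places) (Larch : Fin 3 → ℂ → ℂ) :
    ∀ v : (toyNSideP d43 Larch).d42.Place, (toyNSideP d43 Larch).d41.thetaNonzero (Sum.inl v) :=
  fun _ => trivial

/-- `(H_loc)` on the parametric side. -/
theorem toyNSideP_hloc (d43 : N43Places) (Larch : Fin 3 → ℂ → ℂ) :
    (toyNSideP d43 Larch).d41.Hloc :=
  fun _ => trivial

/-- `(R1) ∧ (H_loc)` in N4.1's words, for any factors of Eischen–Liu shape. -/
theorem toyNSideP_R1AndHloc (d43 : N43Places) {Larch : Fin 3 → ℂ → ℂ}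
    (hL : ∀ j, ELShape (Larch j)) : (toyNSideP d43 Larch).R1AndHloc :=
  ⟨(toyD41P_N41E hL).1, toyNSideP_hloc d43 Larch⟩

/-- THE N4.3 SEAM: `ArchNonvanishing` of the parametric side from t6-p6's ten N4.3 binders on
`d43` with the factors `Larch` (the side's real-place factors ARE `Larch j`, by `rfl`). -/
theorem toyNSideP_archNonvanishing (d43 : N43Places) (Larch : Fin 3 → ℂ → ℂ)
    (h₁ : d43.d₁.CharacterCoefficient d43.m)
    (hEL₁ : Hyp.EischenLiu2024_Sec2_2 2 0 d43.τ₁ d43.ν₁ d43.r₁ (Larch 0))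
    (h₂f : d43.d₂.FockLineIdentification) (h₂l : d43.d₂.LowestWeightCoefficient)
    (h₂r : Hyp.Ruhl1970_A2f d43.d₂)
    (hEL₂ : Hyp.EischenLiu2024_Sec2_2 1 1 d43.τ₂ d43.ν₂ d43.r₂ (Larch 1))
    (h₃f : d43.d₃.FockLineIdentification) (h₃l : d43.d₃.LowestWeightCoefficient)
    (h₃r : Hyp.Ruhl1970_A2f d43.d₃)
    (hEL₃ : Hyp.EischenLiu2024_Sec2_2 1 1 d43.τ₃ d43.ν₃ d43.r₃ (Larch 2)) :
    (toyNSideP d43 Larch).ArchNonvanishing :=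
  N43Places.archNonvanishing_withLfac d43 Larch h₁ hEL₁ h₂f h₂l h₂r hEL₂ h₃f h₃l h₃r hEL₃

/-- The three Eischen–Liu displays of the N4.3 slots give the shape hypothesis of N4.1's lemma
set — the seam costs nothing beyond t6-p6's own binders. -/
theorem elShape_of_displays {d43 : N43Places} {Larch : Fin 3 → ℂ → ℂ}
    (hEL₁ : Hyp.EischenLiu2024_Sec2_2 2 0 d43.τ₁ d43.ν₁ d43.r₁ (Larch 0))
    (hEL₂ : Hyp.EischenLiu2024_Sec2_2 1 1 d43.τ₂ d43.ν₂ d43.r₂ (Larch 1))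
    (hEL₃ : Hyp.EischenLiu2024_Sec2_2 1 1 d43.τ₃ d43.ν₃ d43.r₃ (Larch 2)) :
    ∀ j, ELShape (Larch j) := by
  intro j
  match j with
  | 0 => exact elShape_of_eischenLiu hEL₁
  | 1 => exact elShape_of_eischenLiu hEL₂
  | 2 => exact elShape_of_eischenLiu hEL₃

/-- README §10.5(ii)(d) for the N4 side, PARAMETRIC: on `toyNSideP d43 Larch` the binders of N4.2
(`N42_side`, on the toy's `d42`), N4.1 (`N41_main`, on `toyD41P Larch`) and N4.3 (the ten binders of
`N43_places_withLfac` on `d43` with the factors `Larch`) are jointly satisfied, and the three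
owners' conclusions follow — `(R1) ∧ (H_loc)` and `ArchNonvanishing`. -/
theorem toyNSideP_N4 (d43 : N43Places) (Larch : Fin 3 → ℂ → ℂ)
    (h₁ : d43.d₁.CharacterCoefficient d43.m)
    (hEL₁ : Hyp.EischenLiu2024_Sec2_2 2 0 d43.τ₁ d43.ν₁ d43.r₁ (Larch 0))
    (h₂f : d43.d₂.FockLineIdentification) (h₂l : d43.d₂.LowestWeightCoefficient)
    (h₂r : Hyp.Ruhl1970_A2f d43.d₂)
    (hEL₂ : Hyp.EischenLiu2024_Sec2_2 1 1 d43.τ₂ d43.ν₂ d43.r₂ (Larch 1))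
    (h₃f : d43.d₃.FockLineIdentification) (h₃l : d43.d₃.LowestWeightCoefficient)
    (h₃r : Hyp.Ruhl1970_A2f d43.d₃)
    (hEL₃ : Hyp.EischenLiu2024_Sec2_2 1 1 d43.τ₃ d43.ν₃ d43.r₃ (Larch 2)) :
    (toyNSideP d43 Larch).R1AndHloc ∧ (toyNSideP d43 Larch).ArchNonvanishing :=
  ⟨toyNSideP_R1AndHloc d43 (elShape_of_displays hEL₁ hEL₂ hEL₃),
    toyNSideP_archNonvanishing d43 Larch h₁ hEL₁ h₂f h₂l h₂r hEL₂ h₃f h₃l h₃r hEL₃⟩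

/-- The original joint witness, re-derived as the instance. -/
theorem toyNSide_N4' : toyNSide.R1AndHloc ∧ toyNSide.ArchNonvanishing :=
  toyNSideP_N4 N43Places.toy toyLvArch N43Toy.toyU2_char N43Toy.toyU2_EL N43Toy.toyU11_fock
    N43Toy.toyU11_lowest N43Toy.toyU11_A2f N43Toy.toyU11_EL N43Toy.toyU11_fock N43Toy.toyU11_lowest
    N43Toy.toyU11_A2f N43Toy.toyU11_EL

end Summit.Ventures.HodgeRepro2.T6.N42ToyNSideP
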